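/-
VALUE = THEOREM / DECIDABLE VERDICT at p = 5 (kernel- and compiler-certified evaluation), NOT summit
progress (cell b2b-lgcu-borel, gen 23); the crux item stmt-MatrixMultiplication-14079 is untouched.
-/
import Mathlib
import Summits.MatrixMultiplication.MatrixMultiplication.Theorems.SubgroupIdentityDesigns.Negative.PermutationCertificate
import Summits.MatrixMultiplication.MatrixMultiplication.Theorems.SubgroupIdentityDesigns.Negative.NonsquareReflectionsFour

/-!
# No member contains the non-square reflections of `𝔽₅³`: the order-120 class of `GL₃(𝔽₅)`

VALUE = THEOREM / DECIDABLE VERDICT (`p = 5`, every `ε`, no TPP, no budget; every `m ≥ 3` through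
`SummandTransport`), NOT summit progress; the crux item stmt-MatrixMultiplication-14079 is untouched
and remains open.

THE CLASS.  `K = ⟨R_b : b·b ∈ {2,3}⟩ < O₃(𝔽₅)`, the group generated by the ten non-square reflections
of `(𝔽₅³, x²+y²+z²)`; `|K| = 120`, `K = Ω₃ ∪ −(SO₃ ∖ Ω₃) ≅ PGL₂(𝔽₅) ≅ S₅`.  It is the one minimal class
of the `(3,5)` catalogue of subgroups meeting the level-one space in a proper subspace that no earlier
criterion reaches: its isotropic-vector stabilisers lie in `SL₃` (no determinant / character / fixed-vector
certificate: `NonsquareReflections` needs `p ≡ 3 (mod 4)`, `NonsquareReflectionsFour` needs `m ≥ 4`),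
and it is no `SL₂`-image (`CuspidalObstruction`).  What is missing from `F₁|_K` is one cuspidal
representation of degree `4`.

THE CERTIFICATE (`PermutationCertificate.no_design_of_permCert`, evaluated).  `Ω = 𝔽₅³` with the
UNTWISTED action `k ⋆ v = det(k)·(k v)` (`act`) and the weight (`wt`)
  `w(v) = 4·[v = X₀] − 4·[v = −X₀] + [v ≠ ±X₀]·[Q(v) = 2]·(χ(Q(v + X₀)) − χ(Q(v − X₀)))`,
`X₀ = (0,1,1)`, `Q(v) = v·v`, `χ` the quadratic character of `𝔽₅`: the stabiliser orbit sums
`Σ_{s ∈ K, s x = x} w(s ⋆ ω)` vanish for all `x ≠ 0` and all `ω` (`orbit_sums`, `native_decide`: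
`124 × 125` sums over the materialised `120`-element set `KS`), and `w(X₀) = 4 ≠ 0`.  The same formula
with `4 ↦ p − 1` is the certificate of the whole family `K_p⁻`, `p ≡ 1 (mod 4)` (checked exactly for
`p = 13` and by sampling for `p = 17, 29` in `code/g23/perm_cert.py`; its all-`p` proof is three
quadratic character sums — successor work), so this file is the `p = 5` instance of a family, decided.

THEOREMS.  `no_design_of_cover_five` (every `k ∈ K ∖ 1` a triple product `⇒` no level-one identity
design), `no_design_mem₁/₂/₃_five` (no member contains all non-square reflections of `𝔽₅³`), and for
every `m ≥ 3` `no_design_mem₁/₂/₃_five_of_three_le` (no member of a triple in `GL_m(𝔽₅)` contains all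
non-square reflections of `𝔽₅^m`; for `m ≥ 4` this is also `NonsquareReflectionsFour`).  With
`NonsquareReflections(Four)`, `SquareReflections` and `AllReflections`: for every odd `p` and `m ≥ 3`
no member contains all reflections of one square class of `𝔽_p^m`, except possibly `m = 3` and the
class of sign `−χ(−1)` for `p ≥ 7` (`Ω₃ × ⟨−1⟩` for `p ≡ 3`, `K_p⁻` for `p ≡ 1 (mod 4)`, `p ≥ 13`).
CATALOGUE: all `15` minimal classes of the `(3,5)` catalogue are now instances of Lean theorems.

HONEST SCOPE.  Configuration exclusion at `p = 5`; no `(p,m,ε)` cell is emptied.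
-/

set_option linter.dupNamespace false

open scoped BigOperators Matrix

namespace Summit.MatrixMultiplication.MatrixMultiplication.Theorems.SubgroupIdentityDesigns.Negative
namespace NonsquareReflectionsFive

open Summit.MatrixMultiplication.MatrixMultiplication.Theorems.LieRankDesigns.Negative (GLm Mat)
open NonsquareReflections (refl reflMat coe_refl reflGroup reflGroup_le extVec extVec_dotProduct
  emb_refl)
open SummandTransport (emb design_comap)
open PermutationCertificate (no_design_of_permCert)

/-- `5` is prime (instance for the level vocabulary at `p = 5`). -/
instance fact_prime_five : Fact (Nat.Prime 5) := ⟨by norm_num⟩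

/-- `𝔽₅³`. -/
abbrev V : Type := Fin 3 → ZMod 5

/-! ## The class `K` as data -/

/-- Re-materialise a unit of `GL₃(𝔽₅)` entrywise (so that compiled evaluation of iterated products
does not re-expand closures). -/
def norm (g : GLm 5 3) : GLm 5 3 where
  val := !![(g : Mat 5 3) 0 0, (g : Mat 5 3) 0 1, (g : Mat 5 3) 0 2;
            (g : Mat 5 3) 1 0, (g : Mat 5 3) 1 1, (g : Mat 5 3) 1 2;
            (g : Mat 5 3) 2 0, (g : Mat 5 3) 2 1, (g : Mat 5 3) 2 2]
  inv := !![((g⁻¹ : GLm 5 3) : Mat 5 3) 0 0, ((g⁻¹ : GLm 5 3) : Mat 5 3) 0 1,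
              ((g⁻¹ : GLm 5 3) : Mat 5 3) 0 2;
            ((g⁻¹ : GLm 5 3) : Mat 5 3) 1 0, ((g⁻¹ : GLm 5 3) : Mat 5 3) 1 1,
              ((g⁻¹ : GLm 5 3) : Mat 5 3) 1 2;
            ((g⁻¹ : GLm 5 3) : Mat 5 3) 2 0, ((g⁻¹ : GLm 5 3) : Mat 5 3) 2 1,
              ((g⁻¹ : GLm 5 3) : Mat 5 3) 2 2]
  val_inv := by
    have h : (g : Mat 5 3) * ((g⁻¹ : GLm 5 3) : Mat 5 3) = 1 := by
      rw [← Units.val_mul, mul_inv_cancel, Units.val_one]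
    rw [← h]
    congr 1 <;> exact Matrix.ext fun i j => by fin_cases i <;> fin_cases j <;> rfl
  inv_val := by
    have h : ((g⁻¹ : GLm 5 3) : Mat 5 3) * (g : Mat 5 3) = 1 := by
      rw [← Units.val_mul, inv_mul_cancel, Units.val_one]
    rw [← h]
    congr 1 <;> exact Matrix.ext fun i j => by fin_cases i <;> fin_cases j <;> rfl

/-- `norm g = g`. -/
theorem norm_eq (g : GLm 5 3) : norm g = g :=
  Units.ext (Matrix.ext fun i j => by fin_cases i <;> fin_cases j <;> rfl)

/-- The ten non-square reflections `R_b`, `b·b ∈ {2,3}`, of `𝔽₅³`. -/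
def R : Finset (GLm 5 3) :=
  (Finset.univ.filter fun b : V => ¬ IsSquare (b ⬝ᵥ b)).image fun b => norm (refl b)

/-- One closure step: `S ↦ S ∪ S·R`. -/
def step (S : Finset (GLm 5 3)) : Finset (GLm 5 3) :=
  S ∪ (S ×ˢ R).image fun ab => norm (ab.1 * ab.2)

/-- `K` as data: the words of length `≤ 4` in the non-square reflections (`|KS| = 120`). -/
def KS : Finset (GLm 5 3) := step (step (step (step {1})))

/-- Any subgroup containing the non-square reflections contains `step S` if it contains `S`. -/
theorem step_sub {H : Subgroup (GLm 5 3)} (hR : ∀ b : V, ¬ IsSquare (b ⬝ᵥ b) → refl b ∈ H)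
    {S : Finset (GLm 5 3)} (hS : ∀ k ∈ S, k ∈ H) : ∀ k ∈ step S, k ∈ H := by
  intro k hk
  unfold step at hk
  rcases Finset.mem_union.mp hk with hk | hk
  · exact hS k hk
  · obtain ⟨ab, hab, rfl⟩ := Finset.mem_image.mp hk
    obtain ⟨ha, hb⟩ := Finset.mem_product.mp hab
    unfold R at hb
    obtain ⟨b, hb', hbe⟩ := Finset.mem_image.mp hb
    rw [norm_eq]
    refine H.mul_mem (hS _ ha) ?_
    rw [← hbe, norm_eq]
    exact hR b (Finset.mem_filter.mp hb').2

/-- **`KS` lies in every subgroup containing the non-square reflections of `𝔽₅³`.** -/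
theorem KS_sub {H : Subgroup (GLm 5 3)} (hR : ∀ b : V, ¬ IsSquare (b ⬝ᵥ b) → refl b ∈ H) :
    ∀ k ∈ KS, k ∈ H :=
  step_sub hR (step_sub hR (step_sub hR (step_sub hR fun k hk => by
    rw [Finset.mem_singleton.mp hk]; exact H.one_mem)))

/-- Closure data of `KS` (evaluated): `1 ∈ KS`, no product leaves `KS`, no inverse leaves `KS`,
`|KS| = 120`. -/
theorem KS_facts : (1 : GLm 5 3) ∈ KS ∧ ((KS ×ˢ KS).filter fun ab => ¬ ab.1 * ab.2 ∈ KS) = ∅ ∧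
    (KS.filter fun a => ¬ a⁻¹ ∈ KS) = ∅ ∧ KS.card = 120 := by
  native_decide

/-- `KS` is closed under products. -/
theorem KS_mul : ∀ a ∈ KS, ∀ b ∈ KS, a * b ∈ KS := fun a ha b hb => by
  have h := Finset.filter_eq_empty_iff.mp KS_facts.2.1 (Finset.mk_mem_product ha hb)
  exact not_not.mp h

/-- `KS` is closed under inverses. -/
theorem KS_inv : ∀ a ∈ KS, a⁻¹ ∈ KS := fun _ ha =>
  not_not.mp (Finset.filter_eq_empty_iff.mp KS_facts.2.2.1 ha)

/-! ## The certificate: untwisted action and weight -/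

/-- The `3 × 3` determinant, written out. -/
def det3 (M : Mat 5 3) : ZMod 5 :=
  M 0 0 * M 1 1 * M 2 2 - M 0 0 * M 1 2 * M 2 1 - M 0 1 * M 1 0 * M 2 2 + M 0 1 * M 1 2 * M 2 0 +
    M 0 2 * M 1 0 * M 2 1 - M 0 2 * M 1 1 * M 2 0

/-- `det3 = det`. -/
theorem det3_eq (M : Mat 5 3) : det3 M = M.det := (Matrix.det_fin_three M).symm

/-- The untwisted action `k ⋆ v = det(k) · (k v)` of `GL₃(𝔽₅)` on `𝔽₅³`. -/
def act (s : GLm 5 3) (v : V) : V := det3 (s : Mat 5 3) • ((s : Mat 5 3) *ᵥ v)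

/-- `act` is multiplicative. -/
theorem act_mul (a b : GLm 5 3) (v : V) : act (a * b) v = act a (act b v) := by
  simp only [act, det3_eq, Units.val_mul, Matrix.det_mul, ← Matrix.mulVec_mulVec, Matrix.mulVec_smul,
    smul_smul]

/-- `act 1 = id`. -/
theorem act_one (v : V) : act 1 v = v := by
  simp only [act, det3_eq, Units.val_one, Matrix.det_one, Matrix.one_mulVec, one_smul]

/-- The quadratic character of `𝔽₅` (`0 ↦ 0`). -/
def chi (a : ZMod 5) : ℤ := if a = 0 then 0 else if IsSquare a then 1 else -1

/-- The base point `X₀ = (0,1,1)` of the non-square sphere `Q = 2`. -/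
def X₀ : V := ![0, 1, 1]

/-- The weight `w(v) = 4[v = X₀] − 4[v = −X₀] + [v ≠ ±X₀][Q(v) = 2](χ(Q(v+X₀)) − χ(Q(v−X₀)))`. -/
def wt (v : V) : ℤ :=
  if v = X₀ then 4 else if v = -X₀ then -4 else
    if v ⬝ᵥ v = 2 then chi ((v + X₀) ⬝ᵥ (v + X₀)) - chi ((v - X₀) ⬝ᵥ (v - X₀)) else 0

/-- `w(X₀) ≠ 0` (evaluated). -/
theorem wt_X₀ : wt X₀ ≠ 0 := by
  native_decide

/-- **THE STABILISER ORBIT SUMS VANISH** (evaluated: all `x ≠ 0` and `ω` in `𝔽₅³`). -/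
theorem orbit_sums : ∀ x : V, x ≠ 0 → ∀ ω : V,
    (∑ s ∈ KS.filter (fun s : GLm 5 3 => (s : Mat 5 3) *ᵥ x = x), wt (act s ω)) = 0 := by
  native_decide

/-! ## The exclusions in `GL₃(𝔽₅)` -/

section GL3

variable {H₁ H₂ H₃ : Subgroup (GLm 5 3)}

/-- **COVER FORM.**  If every non-trivial element of the group generated by the non-square reflections
of `𝔽₅³` is a triple product `a b g ∈ H₁ H₂ H₃`, then `(H₁, H₂, H₃)` carries no level-one identity
design. -/
theorem no_design_of_cover_five
    (hmem : ∀ k ∈ reflGroup 5 3, k ≠ 1 → ∃ a ∈ H₁, ∃ b ∈ H₂, ∃ g ∈ H₃, a * b * g = k) :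
    ¬ ∃ c : Mat 5 3 → ℂ, (∀ M, 1 < M.rank → c M = 0) ∧
      (∑ M, c M * ZMod.stdAddChar (Matrix.trace (M * ((1 : GLm 5 3) : Mat 5 3)))) = 1 ∧
      ∀ a ∈ H₁, ∀ b ∈ H₂, ∀ g ∈ H₃, a * b * g ≠ 1 →
        (∑ M, c M * ZMod.stdAddChar (Matrix.trace (M * ((a * b * g : GLm 5 3) : Mat 5 3)))) = 0 :=
  no_design_of_permCert KS KS_facts.1 KS_mul KS_inv act act_mul act_one wt ⟨X₀, wt_X₀⟩ orbit_sums
    fun k hk hk1 =>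
      hmem k (KS_sub (H := reflGroup 5 3) (fun b hb => Subgroup.subset_closure ⟨b, hb, rfl⟩) k hk) hk1

/-- **No member contains all non-square reflections of `𝔽₅³`**: member `1`. -/
theorem no_design_mem₁_five (h₁ : ∀ b : V, ¬ IsSquare (b ⬝ᵥ b) → refl b ∈ H₁) :
    ¬ ∃ c : Mat 5 3 → ℂ, (∀ M, 1 < M.rank → c M = 0) ∧
      (∑ M, c M * ZMod.stdAddChar (Matrix.trace (M * ((1 : GLm 5 3) : Mat 5 3)))) = 1 ∧
      ∀ a ∈ H₁, ∀ b ∈ H₂, ∀ g ∈ H₃, a * b * g ≠ 1 →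
        (∑ M, c M * ZMod.stdAddChar (Matrix.trace (M * ((a * b * g : GLm 5 3) : Mat 5 3)))) = 0 :=
  no_design_of_cover_five (triple_of_le₁ (reflGroup_le h₁))

/-- Member `2`. -/
theorem no_design_mem₂_five (h₂ : ∀ b : V, ¬ IsSquare (b ⬝ᵥ b) → refl b ∈ H₂) :
    ¬ ∃ c : Mat 5 3 → ℂ, (∀ M, 1 < M.rank → c M = 0) ∧
      (∑ M, c M * ZMod.stdAddChar (Matrix.trace (M * ((1 : GLm 5 3) : Mat 5 3)))) = 1 ∧
      ∀ a ∈ H₁, ∀ b ∈ H₂, ∀ g ∈ H₃, a * b * g ≠ 1 →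
        (∑ M, c M * ZMod.stdAddChar (Matrix.trace (M * ((a * b * g : GLm 5 3) : Mat 5 3)))) = 0 :=
  no_design_of_cover_five (triple_of_le₂ (reflGroup_le h₂))

/-- Member `3`. -/
theorem no_design_mem₃_five (h₃ : ∀ b : V, ¬ IsSquare (b ⬝ᵥ b) → refl b ∈ H₃) :
    ¬ ∃ c : Mat 5 3 → ℂ, (∀ M, 1 < M.rank → c M = 0) ∧
      (∑ M, c M * ZMod.stdAddChar (Matrix.trace (M * ((1 : GLm 5 3) : Mat 5 3)))) = 1 ∧
      ∀ a ∈ H₁, ∀ b ∈ H₂, ∀ g ∈ H₃, a * b * g ≠ 1 →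
        (∑ M, c M * ZMod.stdAddChar (Matrix.trace (M * ((a * b * g : GLm 5 3) : Mat 5 3)))) = 0 :=
  no_design_of_cover_five (triple_of_le₃ (reflGroup_le h₃))

end GL3

/-! ## Every dimension `m ≥ 3` -/

section GLm

variable {l n : ℕ} (e : Fin 3 ⊕ Fin l ≃ Fin n) {H₁ H₂ H₃ : Subgroup (GLm 5 n)}

/-- No member contains the non-square reflections of three coordinates of `𝔽₅^n`: member `1`. -/
theorem no_design_mem₁_five_all (h₁ : ∀ b : V, ¬ IsSquare (b ⬝ᵥ b) → emb e (refl b) ∈ H₁) :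
    ¬ ∃ c : Mat 5 n → ℂ, (∀ M, 1 < M.rank → c M = 0) ∧
      (∑ M, c M * ZMod.stdAddChar (Matrix.trace (M * ((1 : GLm 5 n) : Mat 5 n)))) = 1 ∧
      ∀ a ∈ H₁, ∀ b ∈ H₂, ∀ g ∈ H₃, a * b * g ≠ 1 →
        (∑ M, c M * ZMod.stdAddChar (Matrix.trace (M * ((a * b * g : GLm 5 n) : Mat 5 n)))) = 0 :=
  fun hdes => no_design_mem₁_five (H₁ := H₁.comap (emb e)) (H₂ := H₂.comap (emb e))
    (H₃ := H₃.comap (emb e)) (fun b hb => Subgroup.mem_comap.mpr (h₁ b hb)) (design_comap e 1 hdes)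

/-- Three coordinates of `𝔽₅^n`, member `2`. -/
theorem no_design_mem₂_five_all (h₂ : ∀ b : V, ¬ IsSquare (b ⬝ᵥ b) → emb e (refl b) ∈ H₂) :
    ¬ ∃ c : Mat 5 n → ℂ, (∀ M, 1 < M.rank → c M = 0) ∧
      (∑ M, c M * ZMod.stdAddChar (Matrix.trace (M * ((1 : GLm 5 n) : Mat 5 n)))) = 1 ∧
      ∀ a ∈ H₁, ∀ b ∈ H₂, ∀ g ∈ H₃, a * b * g ≠ 1 →
        (∑ M, c M * ZMod.stdAddChar (Matrix.trace (M * ((a * b * g : GLm 5 n) : Mat 5 n)))) = 0 :=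
  fun hdes => no_design_mem₂_five (H₁ := H₁.comap (emb e)) (H₂ := H₂.comap (emb e))
    (H₃ := H₃.comap (emb e)) (fun b hb => Subgroup.mem_comap.mpr (h₂ b hb)) (design_comap e 1 hdes)

/-- Three coordinates of `𝔽₅^n`, member `3`. -/
theorem no_design_mem₃_five_all (h₃ : ∀ b : V, ¬ IsSquare (b ⬝ᵥ b) → emb e (refl b) ∈ H₃) :
    ¬ ∃ c : Mat 5 n → ℂ, (∀ M, 1 < M.rank → c M = 0) ∧
      (∑ M, c M * ZMod.stdAddChar (Matrix.trace (M * ((1 : GLm 5 n) : Mat 5 n)))) = 1 ∧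
      ∀ a ∈ H₁, ∀ b ∈ H₂, ∀ g ∈ H₃, a * b * g ≠ 1 →
        (∑ M, c M * ZMod.stdAddChar (Matrix.trace (M * ((a * b * g : GLm 5 n) : Mat 5 n)))) = 0 :=
  fun hdes => no_design_mem₃_five (H₁ := H₁.comap (emb e)) (H₂ := H₂.comap (emb e))
    (H₃ := H₃.comap (emb e)) (fun b hb => Subgroup.mem_comap.mpr (h₃ b hb)) (design_comap e 1 hdes)

end GLm

section CoordinateFree

variable {m : ℕ}

/-- **NO MEMBER OF A TRIPLE IN `GL_m(𝔽₅)`, `m ≥ 3`, CONTAINS ALL NON-SQUARE REFLECTIONS OF `𝔽₅^m`**: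
member `1`. -/
theorem no_design_mem₁_five_of_three_le (hm : 3 ≤ m) {H₁ H₂ H₃ : Subgroup (GLm 5 m)}
    (h₁ : ∀ b : Fin m → ZMod 5, ¬ IsSquare (b ⬝ᵥ b) → refl b ∈ H₁) :
    ¬ ∃ c : Mat 5 m → ℂ, (∀ M, 1 < M.rank → c M = 0) ∧
      (∑ M, c M * ZMod.stdAddChar (Matrix.trace (M * ((1 : GLm 5 m) : Mat 5 m)))) = 1 ∧
      ∀ a ∈ H₁, ∀ b ∈ H₂, ∀ g ∈ H₃, a * b * g ≠ 1 →
        (∑ M, c M * ZMod.stdAddChar (Matrix.trace (M * ((a * b * g : GLm 5 m) : Mat 5 m)))) = 0 := by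
  obtain ⟨l, rfl⟩ := Nat.exists_eq_add_of_le hm
  exact no_design_mem₁_five_all finSumFinEquiv fun b hb => by
    rw [emb_refl]
    exact h₁ _ (by rwa [extVec_dotProduct])

/-- Member `2`, `m ≥ 3`. -/
theorem no_design_mem₂_five_of_three_le (hm : 3 ≤ m) {H₁ H₂ H₃ : Subgroup (GLm 5 m)}
    (h₂ : ∀ b : Fin m → ZMod 5, ¬ IsSquare (b ⬝ᵥ b) → refl b ∈ H₂) :
    ¬ ∃ c : Mat 5 m → ℂ, (∀ M, 1 < M.rank → c M = 0) ∧
      (∑ M, c M * ZMod.stdAddChar (Matrix.trace (M * ((1 : GLm 5 m) : Mat 5 m)))) = 1 ∧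
      ∀ a ∈ H₁, ∀ b ∈ H₂, ∀ g ∈ H₃, a * b * g ≠ 1 →
        (∑ M, c M * ZMod.stdAddChar (Matrix.trace (M * ((a * b * g : GLm 5 m) : Mat 5 m)))) = 0 := by
  obtain ⟨l, rfl⟩ := Nat.exists_eq_add_of_le hm
  exact no_design_mem₂_five_all finSumFinEquiv fun b hb => by
    rw [emb_refl]
    exact h₂ _ (by rwa [extVec_dotProduct])

/-- Member `3`, `m ≥ 3`. -/
theorem no_design_mem₃_five_of_three_le (hm : 3 ≤ m) {H₁ H₂ H₃ : Subgroup (GLm 5 m)}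
    (h₃ : ∀ b : Fin m → ZMod 5, ¬ IsSquare (b ⬝ᵥ b) → refl b ∈ H₃) :
    ¬ ∃ c : Mat 5 m → ℂ, (∀ M, 1 < M.rank → c M = 0) ∧
      (∑ M, c M * ZMod.stdAddChar (Matrix.trace (M * ((1 : GLm 5 m) : Mat 5 m)))) = 1 ∧
      ∀ a ∈ H₁, ∀ b ∈ H₂, ∀ g ∈ H₃, a * b * g ≠ 1 →
        (∑ M, c M * ZMod.stdAddChar (Matrix.trace (M * ((a * b * g : GLm 5 m) : Mat 5 m)))) = 0 := by
  obtain ⟨l, rfl⟩ := Nat.exists_eq_add_of_le hm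
  exact no_design_mem₃_five_all finSumFinEquiv fun b hb => by
    rw [emb_refl]
    exact h₃ _ (by rwa [extVec_dotProduct])

end CoordinateFree

end NonsquareReflectionsFive
end Summit.MatrixMultiplication.MatrixMultiplication.Theorems.SubgroupIdentityDesigns.Negative
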